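import Summits.NavierStokesRegularity.NavierStokesRegularity.Theorems.TerminalTraceTypeITraceScarL3NoConcentrationLipschitz

set_option linter.dupNamespace false

/-!
# No local `L²` concentration at the blow-up time, I-b: regular top points (nsreg-C26-p1 g3)

Setting of item `TerminalTrace.TypeITraceScarL3` (stmt-NavierStokesRegularity-18385) at unit
viscosity: `(u,p)` classical on `[0,T) × ℝ³` and Leray–Hopf on `[0,T]` (so every slice `u(t)`,
`0 ≤ t ≤ T`, is in `L²` and `t ↦ ∫⟪u(t), w⟫` is continuous on `(0,T]` for `w ∈ L²`).  A point `y`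
is a REGULAR top point if `u` is essentially bounded on some backward cylinder `Q_r(T,y)`.

`localEnergy_sub_top_le_of_regular_unit`: at a regular top point `y` there is a radius `r > 0`
such that `∫_{B(y,r)} |u(t) − u(T)|² → 0` as `t → T⁻` (quantified form: for every `θ > 0` the
integral is `≤ θ` on a final interval).  Proof (no Arzelà–Ascoli): on a late cylinder about `(T,y)`
the slices `u(t,·)` are `K`-Lipschitz UNIFORMLY in `t < T` — higher regularity of bounded suitable
weak solutions (`NSBoundedHigherRegularityBounds_holds`, Seregin–Šverák 2009 §2) applied to the pair
`(u, q)` with Tao's gauged pressure `q` (`gaugedPressure_suitable_and_memLp`: `q ∈ L^{3/2}` of the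
cylinder), the smooth representative being `u` itself below `T` — while the bump pairings
`∫⟪u(t), ψ_h(· − k)eᵢ⟫` are continuous in `t` up to `T` (Leray–Hopf weak continuity); an `h`-net of
the ball turns the two into a UNIFORM Cauchy estimate `sup_{B(y,r)} |u(t) − u(t')| ≤ θ₀` for
`t, t' ∈ (t₀,T)`, and the passage `t' → T⁻` is done in the weak topology with Young's inequality
(`∫_B ⟪u(t) − u(t'), u(t) − u(T)⟫ → ∫_B |u(t) − u(T)|²`).  Part II (`…NoConcentration.lean`) adds the
Type-I Morrey bound and CKN's `ℋ¹`-nullity of the top singular set to reach EVERY point.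

WHAT THIS IS NOT: no statement at singular points here; not 18385; NOT Navier–Stokes regularity.
-/

noncomputable section

open MeasureTheory Set Function Metric Filter Topology Literature.Analysis.FluidPDE
open scoped ENNReal NNReal RealInnerProductSpace

namespace Summit.NavierStokesRegularity.NavierStokesRegularity.Theorems.TypeITraceScarL3
/-- **No local `L²` concentration at a REGULAR top point** (module docstring).  For a classical
solution `(u,p)` on `[0,T)` which is Leray–Hopf on `[0,T]` (unit viscosity), if `u` is essentially
bounded on some backward cylinder at `(T,y)`, then there is `r > 0` such that for every `θ > 0`,
`∫_{B(y,r)} |u(t) − u(T)|² ≤ θ` for all `t` in a final interval `(t₀, T)`.  Proof: uniform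
`K`-Lipschitz slices up to the top (`exists_lipschitz_slices_near_regular_top`) + continuity of the
bump pairings in time (Leray–Hopf weak continuity) on a finite `h`-net ⇒ uniform Cauchy estimate in
`t`; the passage `t' → T⁻` in the weak topology with Young's inequality.
[cite: SereginSverak2009, §2 p. 8; Leray1934, §31; Tao2011, Lemma 4.1 (i)] -/
theorem localEnergy_sub_top_le_of_regular_unit {T : ℝ} (hT : 0 < T)
    {u : ℝ → EuclideanSpace ℝ (Fin 3) → EuclideanSpace ℝ (Fin 3)}
    {p : ℝ → EuclideanSpace ℝ (Fin 3) → ℝ}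
    (hcl : IsClassicalNSSolutionOn (Ico 0 T) 1 0 u p) (hLH : IsLerayHopfOn T 1 0 (u 0) u)
    {y : EuclideanSpace ℝ (Fin 3)} (hreg : ¬ IsBackwardSingularPoint u ((T, y) : ℝ × EuclideanSpace ℝ (Fin 3))) :
    ∃ r : ℝ, 0 < r ∧ ∀ θ : ℝ, 0 < θ → ∃ t₀ : ℝ, t₀ < T ∧ ∀ t ∈ Ioo t₀ T,
      ∫⁻ z in ball y r, ‖u t z - u T z‖ₑ ^ 2 ≤ ENNReal.ofReal θ := by
  classical
  simp only [IsBackwardSingularPoint, not_forall] at hreg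
  obtain ⟨r₀, hr₀, hfin₀⟩ := hreg
  obtain ⟨r₁, a, K, hr₁pos, -, -, ha_pos, ha_lt, hK0, hlip⟩ :=
    exists_lipschitz_slices_near_regular_top hT hcl hLH hr₀ hfin₀
  refine ⟨r₁ / 8, by positivity, fun θ hθ => ?_⟩
  set r : ℝ := r₁ / 8 with hr
  have hrpos : 0 < r := by positivity
  -- continuity of the slices below `T`
  have hcont_t : ∀ t ∈ Ioo a T, Continuous (u t) := fun t ht =>
    (hcl.contDiff_velocity ⟨ha_pos.le.trans ht.1.le, ht.2⟩).continuous
  -- ### constants: `θ₀` with `θ₀² · (|B(y,r)| + 1) = θ`, mesh `h`, tolerance `τ`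
  have hvol : volume (ball y r) ≠ ∞ := measure_ball_lt_top.ne
  set v : ℝ := (volume (ball y r)).toReal + 1 with hv
  have hvpos : 0 < v := by positivity
  set θ₀ : ℝ := Real.sqrt (θ / v) with hθ₀
  have hθ₀pos : 0 < θ₀ := Real.sqrt_pos.2 (div_pos hθ hvpos)
  have hθ₀sq : θ₀ ^ 2 = θ / v := Real.sq_sqrt (div_pos hθ hvpos).le
  set K' : ℝ := K + 1 with hK'
  have hK'pos : 0 < K' := by positivity
  have hKK' : K ≤ K' := by rw [hK']; linarith
  set h : ℝ := min (r₁ / 8) (θ₀ / (16 * K')) with hh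
  have hhpos : 0 < h := lt_min (by positivity) (by positivity)
  have hh1 : h ≤ r₁ / 8 := min_le_left _ _
  have hh2 : K' * h ≤ θ₀ / 16 := by
    calc K' * h ≤ K' * (θ₀ / (16 * K')) := mul_le_mul_of_nonneg_left (min_le_right _ _) hK'pos.le
      _ = θ₀ / 16 := by field_simp
  set τ : ℝ := θ₀ / 16 with hτ
  have hτpos : 0 < τ := by positivity
  -- ### the finite `h`-net of `B̄(y, r)`, the bumps and the test fields
  obtain ⟨net, hnetsub, hnetfin, hnetcov⟩ :=
    finite_cover_balls_of_compact (isCompact_closedBall y r) hhpos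
  let b : ∀ k : EuclideanSpace ℝ (Fin 3), ContDiffBump k :=
    fun k => ⟨h / 2, h, half_pos hhpos, half_lt_self hhpos⟩
  have hbr : ∀ k, (b k).rOut = h := fun _ => rfl
  set φ : EuclideanSpace ℝ (Fin 3) → Fin 3 → EuclideanSpace ℝ (Fin 3) → EuclideanSpace ℝ (Fin 3) :=
    fun k i z => (b k).normed volume z • EuclideanSpace.single i (1 : ℝ) with hφ
  have hφs : ∀ k i, ContDiff ℝ (⊤ : ℕ∞) (φ k i) := fun k i =>
    ((b k).contDiff_normed).smul contDiff_const
  have hφc : ∀ k i, HasCompactSupport (φ k i) := fun k i => by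
    have h1 := ((b k).hasCompactSupport_normed (μ := volume)).smul_right
      (f' := fun _ : EuclideanSpace ℝ (Fin 3) => EuclideanSpace.single i (1 : ℝ))
    exact h1
  have hφm : ∀ k i, MemLp (φ k i) 2 volume := fun k i =>
    (hφs k i).continuous.memLp_of_hasCompactSupport (hφc k i)
  -- the pairings `g k i s = ∫⟪u s, φ k i⟫` are continuous on `(0, T]`: a modulus at `T` for each
  have hmod : ∀ k i, ∃ δ : ℝ, 0 < δ ∧ ∀ s ∈ Ioc 0 T, dist s T < δ →
      dist (∫ z, ⟪u s z, φ k i z⟫) (∫ z, ⟪u T z, φ k i z⟫) < τ := by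
    intro k i
    have hc := (hLH.weak_continuous (φ k i) (hφm k i)).1 T ⟨hT, le_rfl⟩
    rw [Metric.continuousWithinAt_iff] at hc
    obtain ⟨δ, hδ, hδc⟩ := hc τ hτpos
    exact ⟨δ, hδ, fun s hs hsd => hδc hs hsd⟩
  choose δ hδpos hδc using hmod
  -- the finitely many indices
  set tF : Finset (EuclideanSpace ℝ (Fin 3)) := hnetfin.toFinset with htF
  have hmem_tF : ∀ k, k ∈ tF ↔ k ∈ net := fun k => by rw [htF, Set.Finite.mem_toFinset]
  obtain ⟨k₀, hk₀t, -⟩ := mem_iUnion₂.1 (hnetcov (mem_closedBall_self hrpos.le))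
  have htFne : tF.Nonempty := ⟨k₀, (hmem_tF k₀).2 hk₀t⟩
  set I : Finset (EuclideanSpace ℝ (Fin 3) × Fin 3) := tF ×ˢ Finset.univ with hI
  have hIne : I.Nonempty := htFne.product Finset.univ_nonempty
  set δm : ℝ := I.inf' hIne (fun q => δ q.1 q.2) with hδm
  have hδmpos : 0 < δm := (Finset.lt_inf'_iff hIne).2 fun q _ => hδpos q.1 q.2
  have hδmle : ∀ q ∈ I, δm ≤ δ q.1 q.2 := fun q hq => Finset.inf'_le _ hq
  set t₀ : ℝ := max a (T - δm) with ht₀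
  have ht₀lt : t₀ < T := max_lt ha_lt (by linarith)
  refine ⟨t₀, ht₀lt, ?_⟩
  have hIoo_a : Ioo t₀ T ⊆ Ioo a T := Ioo_subset_Ioo_left (le_max_left _ _)
  have hIoc : ∀ s ∈ Ioo t₀ T, s ∈ Ioc 0 T := fun s hs =>
    ⟨ha_pos.trans (hIoo_a hs).1, hs.2.le⟩
  have hdistT : ∀ s ∈ Ioo t₀ T, dist s T < δm := fun s hs => by
    rw [dist_comm, Real.dist_eq, abs_of_pos (sub_pos.2 hs.2)]
    have : T - δm ≤ t₀ := le_max_right _ _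
    linarith [hs.1]
  -- ### the uniform Cauchy estimate on `B(y, r)`
  have hcauchy : ∀ t ∈ Ioo t₀ T, ∀ t' ∈ Ioo t₀ T, ∀ z ∈ ball y r, ‖u t z - u t' z‖ ≤ θ₀ := by
    intro t ht t' ht' z hz
    have hta : t ∈ Ioo a T := hIoo_a ht
    have ht'a : t' ∈ Ioo a T := hIoo_a ht'
    obtain ⟨k, hkt, hzk⟩ := mem_iUnion₂.1 (hnetcov (ball_subset_closedBall hz))
    have hky : dist k y ≤ r := hnetsub hkt
    have hk2 : k ∈ ball y (r₁ / 2) := mem_ball.2 (by linarith)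
    have hz2 : z ∈ ball y (r₁ / 2) := mem_ball.2 (by linarith [mem_ball.1 hz])
    have hzk' : ‖z - k‖ ≤ h := by rw [← dist_eq_norm]; exact (mem_ball.1 hzk).le
    -- the coordinates of `u t k − u t' k` through the bump pairings
    have hballk : closedBall k h ⊆ ball y (r₁ / 2) := fun w hw => by
      rw [mem_closedBall] at hw
      rw [mem_ball]
      calc dist w y ≤ dist w k + dist k y := dist_triangle _ _ _
        _ ≤ h + r := add_le_add hw hky
        _ < r₁ / 2 := by linarith
    have hlipk : ∀ s ∈ Ioo a T, ∀ w ∈ ball k (b k).rOut, ‖u s k - u s w‖ ≤ K' * h := by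
      intro s hs w hw
      rw [hbr] at hw
      have hw2 : w ∈ ball y (r₁ / 2) := hballk (ball_subset_closedBall hw)
      calc ‖u s k - u s w‖ ≤ K * ‖k - w‖ := hlip s hs k hk2 w hw2
        _ ≤ K' * h := by
          have hkw : ‖k - w‖ ≤ h := by
            rw [← dist_eq_norm, dist_comm]; exact (mem_ball.1 hw).le
          exact mul_le_mul hKK' hkw (norm_nonneg _) hK'pos.le
    have hcoord : ∀ s ∈ Ioo a T, ∀ i : Fin 3,
        |u s k i - ∫ w, ⟪u s w, φ k i w⟫| ≤ K' * h := fun s hs i =>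
      abs_apply_sub_integral_bump_le (b k) ((hcont_t s hs).continuousOn) (hlipk s hs) i
    have hpair : ∀ i : Fin 3,
        |(∫ w, ⟪u t w, φ k i w⟫) - ∫ w, ⟪u t' w, φ k i w⟫| ≤ 2 * τ := by
      intro i
      have hq : (k, i) ∈ I := Finset.mem_product.2 ⟨(hmem_tF k).2 hkt, Finset.mem_univ _⟩
      have h1 := hδc k i t (hIoc t ht) ((hdistT t ht).trans_le (hδmle _ hq))
      have h2 := hδc k i t' (hIoc t' ht') ((hdistT t' ht').trans_le (hδmle _ hq))
      rw [Real.dist_eq] at h1 h2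
      have := abs_sub_le (∫ w, ⟪u t w, φ k i w⟫) (∫ w, ⟪u T w, φ k i w⟫) (∫ w, ⟪u t' w, φ k i w⟫)
      rw [abs_sub_comm (∫ w, ⟪u T w, φ k i w⟫)] at this
      linarith
    have hcomp : ∀ i : Fin 3, |(u t k - u t' k) i| ≤ 2 * K' * h + 2 * τ := by
      intro i
      have e : (u t k - u t' k) i = (u t k i - ∫ w, ⟪u t w, φ k i w⟫) +
          ((∫ w, ⟪u t w, φ k i w⟫) - ∫ w, ⟪u t' w, φ k i w⟫) -
          (u t' k i - ∫ w, ⟪u t' w, φ k i w⟫) := by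
        simp only [PiLp.sub_apply]; ring
      rw [e]
      have h1 := hcoord t hta i
      have h2 := hcoord t' ht'a i
      have h3 := hpair i
      calc |(u t k i - ∫ w, ⟪u t w, φ k i w⟫) + ((∫ w, ⟪u t w, φ k i w⟫) - ∫ w, ⟪u t' w, φ k i w⟫) -
              (u t' k i - ∫ w, ⟪u t' w, φ k i w⟫)|
          ≤ |u t k i - ∫ w, ⟪u t w, φ k i w⟫| + |(∫ w, ⟪u t w, φ k i w⟫) - ∫ w, ⟪u t' w, φ k i w⟫| +
              |u t' k i - ∫ w, ⟪u t' w, φ k i w⟫| := by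
            refine (abs_sub _ _).trans (add_le_add (abs_add_le _ _) le_rfl)
        _ ≤ K' * h + 2 * τ + K' * h := by linarith
        _ = 2 * K' * h + 2 * τ := by ring
    have hcentre : ‖u t k - u t' k‖ ≤ 2 * (2 * K' * h + 2 * τ) :=
      norm_le_two_mul_of_forall_abs_apply_le (by positivity) hcomp
    -- assemble with the Lipschitz bounds at `z`
    have e : u t z - u t' z = (u t z - u t k) + (u t k - u t' k) + (u t' k - u t' z) := by abel
    rw [e]
    calc ‖(u t z - u t k) + (u t k - u t' k) + (u t' k - u t' z)‖
        ≤ ‖u t z - u t k‖ + ‖u t k - u t' k‖ + ‖u t' k - u t' z‖ := norm_add₃_le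
      _ ≤ K * ‖z - k‖ + 2 * (2 * K' * h + 2 * τ) + K * ‖k - z‖ := by
          refine add_le_add (add_le_add (hlip t hta z hz2 k hk2) hcentre) ?_
          exact hlip t' ht'a k hk2 z hz2
      _ ≤ K' * h + 2 * (2 * K' * h + 2 * τ) + K' * h := by
          have h1 : K * ‖z - k‖ ≤ K' * h := mul_le_mul hKK' hzk' (norm_nonneg _) hK'pos.le
          have h2 : K * ‖k - z‖ ≤ K' * h := by
            rw [norm_sub_rev]; exact h1
          linarith
      _ ≤ θ₀ := by rw [hτ]; linarith
  -- ### the passage `t' → T⁻` in the weak topology (Young's inequality)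
  intro t ht
  have hta : t ∈ Ioo a T := hIoo_a ht
  have htIcc : t ∈ Icc 0 T := ⟨ha_pos.le.trans hta.1.le, ht.2.le⟩
  have hut : MemLp (u t) 2 volume := hLH.memLp t htIcc
  have huT : MemLp (u T) 2 volume := hLH.memLp T ⟨hT.le, le_rfl⟩
  set d : EuclideanSpace ℝ (Fin 3) → EuclideanSpace ℝ (Fin 3) := fun x => u t x - u T x with hd
  have hdmem : MemLp d 2 volume := hut.sub huT
  set w : EuclideanSpace ℝ (Fin 3) → EuclideanSpace ℝ (Fin 3) := (ball y r).indicator d with hw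
  have hwmem : MemLp w 2 volume := hdmem.indicator measurableSet_ball
  -- the real energy `E = ∫_B |d|²` and its relation to the lintegral
  haveI hfinB : IsFiniteMeasure (volume.restrict (ball y r)) := isFiniteMeasure_restrict.2 hvol
  have hdint : Integrable (fun x => ‖d x‖ ^ 2) (volume.restrict (ball y r)) :=
    (hdmem.restrict _).integrable_norm_pow two_ne_zero
  set E : ℝ := ∫ x in ball y r, ‖d x‖ ^ 2 with hE
  have hE0 : 0 ≤ E := integral_nonneg fun x => by positivity
  have hlint : ∫⁻ z in ball y r, ‖u t z - u T z‖ₑ ^ 2 = ENNReal.ofReal E :=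
    lintegral_ball_enorm_sq_eq_ofReal hdmem y r
  -- the pairing `G s = ∫⟪u s, w⟫` and its limit at `T`
  set G : ℝ → ℝ := fun s => ∫ x, ⟪u s x, w x⟫ with hG
  have hGcont : ContinuousWithinAt G (Ioc 0 T) T := (hLH.weak_continuous w hwmem).1 T ⟨hT, le_rfl⟩
  have hGlim : Tendsto G (𝓝[<] T) (𝓝 (G T)) := by
    have h1 : Tendsto G (𝓝[Ioo t₀ T] T) (𝓝 (G T)) :=
      hGcont.mono fun s hs => hIoc s hs
    rwa [nhdsWithin_Ioo_eq_nhdsLT ht₀lt] at h1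
  -- `G t − G T = E`
  have hinner_ind : ∀ (a' : EuclideanSpace ℝ (Fin 3) → EuclideanSpace ℝ (Fin 3)) (x : EuclideanSpace ℝ (Fin 3)),
      ⟪a' x, w x⟫ = (ball y r).indicator (fun x => ⟪a' x, d x⟫) x := by
    intro a' x
    by_cases hx : x ∈ ball y r
    · rw [hw, indicator_of_mem hx, indicator_of_mem hx]
    · rw [hw, indicator_of_notMem hx, indicator_of_notMem hx, inner_zero_right]
  have hGsub : ∀ s ∈ Icc 0 T, G t - G s = ∫ x in ball y r, ⟪u t x - u s x, d x⟫ := by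
    intro s hs
    have hus : MemLp (u s) 2 volume := hLH.memLp s hs
    rw [hG]
    simp only
    rw [← integral_sub (integrable_inner_of_memLp_two hut hwmem) (integrable_inner_of_memLp_two hus hwmem)]
    have e1 : (fun x => ⟪u t x, w x⟫ - ⟪u s x, w x⟫) =
        (ball y r).indicator (fun x => ⟪u t x - u s x, d x⟫) := by
      funext x
      rw [hinner_ind (u t) x, hinner_ind (u s) x]
      by_cases hx : x ∈ ball y r
      · simp only [indicator_of_mem hx, inner_sub_left]
      · simp only [indicator_of_notMem hx, sub_zero]
    rw [e1, integral_indicator measurableSet_ball]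
  have hGT : G t - G T = E := by
    rw [hGsub T ⟨hT.le, le_rfl⟩, hE]
    refine integral_congr_ae (ae_of_all _ fun x => ?_)
    simp only [hd]
    rw [real_inner_self_eq_norm_sq]
  -- Young: for `t' ∈ (t₀,T)`, `G t − G t' ≤ θ₀²/2 · |B| + E/2`
  have hyoung : ∀ t' ∈ Ioo t₀ T,
      G t - G t' ≤ θ₀ ^ 2 / 2 * (volume (ball y r)).toReal + E / 2 := by
    intro t' ht'
    have ht'Icc : t' ∈ Icc 0 T := ⟨ha_pos.le.trans (hIoo_a ht').1.le, ht'.2.le⟩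
    rw [hGsub t' ht'Icc]
    have hpt : ∀ x ∈ ball y r, ⟪u t x - u t' x, d x⟫ ≤ θ₀ ^ 2 / 2 + ‖d x‖ ^ 2 / 2 := by
      intro x hx
      have h1 : ⟪u t x - u t' x, d x⟫ ≤ ‖u t x - u t' x‖ * ‖d x‖ := real_inner_le_norm _ _
      have h2 : ‖u t x - u t' x‖ ≤ θ₀ := hcauchy t ht t' ht' x hx
      have h3 : ‖u t x - u t' x‖ * ‖d x‖ ≤ θ₀ * ‖d x‖ :=
        mul_le_mul_of_nonneg_right h2 (norm_nonneg _)
      nlinarith [sq_nonneg (θ₀ - ‖d x‖), norm_nonneg (d x)]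
    have hint2 : Integrable (fun x => θ₀ ^ 2 / 2 + ‖d x‖ ^ 2 / 2) (volume.restrict (ball y r)) :=
      (integrable_const _).add (hdint.div_const 2)
    have hut' : MemLp (u t') 2 volume := hLH.memLp t' ht'Icc
    have hint1 : Integrable (fun x => ⟪u t x - u t' x, d x⟫) (volume.restrict (ball y r)) :=
      (integrable_inner_of_memLp_two (hut.sub hut') hdmem).restrict
    calc ∫ x in ball y r, ⟪u t x - u t' x, d x⟫
        ≤ ∫ x in ball y r, (θ₀ ^ 2 / 2 + ‖d x‖ ^ 2 / 2) :=
          setIntegral_mono_on hint1 hint2 measurableSet_ball hpt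
      _ = θ₀ ^ 2 / 2 * (volume (ball y r)).toReal + E / 2 := by
          rw [integral_add (integrable_const _) (hdint.div_const 2), setIntegral_const, integral_div,
            ← hE, smul_eq_mul, measureReal_def]
          ring
  -- the limit `t' → T⁻`: `E = G t − G T ≤ θ₀²/2 · |B| + E/2`
  have hlim : Tendsto (fun t' => G t - G t') (𝓝[<] T) (𝓝 (G t - G T)) :=
    tendsto_const_nhds.sub hGlim
  have hev : ∀ᶠ t' in 𝓝[<] T, G t - G t' ≤ θ₀ ^ 2 / 2 * (volume (ball y r)).toReal + E / 2 := by
    rw [← nhdsWithin_Ioo_eq_nhdsLT ht₀lt]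
    exact eventually_nhdsWithin_of_forall fun t' ht' => hyoung t' ht'
  have hEle : E ≤ θ₀ ^ 2 / 2 * (volume (ball y r)).toReal + E / 2 := by
    have := le_of_tendsto hlim hev
    rwa [hGT] at this
  have hEle' : E ≤ θ₀ ^ 2 * (volume (ball y r)).toReal := by linarith
  -- `θ₀² |B| ≤ θ`
  have hfinal : E ≤ θ := by
    refine hEle'.trans ?_
    rw [hθ₀sq, div_mul_eq_mul_div, div_le_iff₀ hvpos, hv]
    have hB0 : 0 ≤ (volume (ball y r)).toReal := ENNReal.toReal_nonneg
    nlinarith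
  rw [hlint]
  exact ENNReal.ofReal_le_ofReal hfinal

end Summit.NavierStokesRegularity.NavierStokesRegularity.Theorems.TypeITraceScarL3

end
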